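import Literature.NumberTheory.LFunctions.ExplicitFormulaPsiCharZeros
import Literature.NumberTheory.LFunctions.ExplicitFormulaPsiProofs
import HarnessLib

/-!
# The truncated explicit formula for `ψ(x, χ)`: `L'/L(s, χ)` by the functional equation, and its
# size on the lines of the contour (Montgomery–Vaughan Lemmas 12.6–12.9)

Topic `Literature/NumberTheory/LFunctions`. THEOREMS (everything proved). Third support file of
the discharge of `Literature.NumberTheory.LFunctions.truncatedExplicitFormula_psiChar`
(Montgomery–Vaughan Thm. 12.10), for a primitive character `χ` modulo `q > 1`:

* `logDeriv_completed_one_sub` — the logarithmic derivative of Mathlib's functional equation: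
  `Λ'/Λ(1 − s, χ) = −log q − Λ'/Λ(s, χ̄)`;
* `logDeriv_LFunction_eq_reflect` — **MV Lemma 12.8 / (10.35)**:
  `L'/L(s, χ) = −log q − L'/L(1 − s, χ̄) − γ'/γ(1 − s) − γ'/γ(s)` (`γ` the Gamma factor);
* `norm_logDeriv_LFunction_le_of_re_ge` — `|L'/L(s, χ)| ≤ ∑ Λ(n) n^{-3/2}` on `σ ≥ 3/2`;
* `exists_norm_logDeriv_LFunction_le_left` — **MV Lemma 12.9**: on `σ ≤ −1/2`, `|t| ≥ 2`,
  `|L'/L(s, χ)| ≤ A + log q + log(|t| + 4) + 5|σ|` (the source has `≪ log(q|s|)`; the linear term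
  is harmless against `x^σ`);
* `exists_norm_logDeriv_LFunction_farLeft_le` — on the far-left lines `σ = −2K − 1/2`, all `t`:
  `|L'/L| ≤ A + log q + 6K + 2|t|`;
* `exists_norm_logDeriv_LFunction_le_strip` — **MV Lemma 12.6–12.7 at a good height**: if every
  non-trivial zero has `|γ − t| ≥ η` (`0 < η ≤ 1`, `|t| ≥ 2`) then on `−1/2 ≤ σ ≤ 3/2`,
  `|L'/L(σ + it, χ)| ≤ C ℒ/η`, `ℒ = log q + log(|t| + 4)`, from the tree's disc partial fraction
  (`Literature.NumberTheory.LFunctions.DirichletDisc.exists_norm_logDeriv_le_of_dist`) on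
  `σ ≥ 1/2` and its reflection through `logDeriv_LFunction_eq_reflect` on `σ < 1/2`.

All constants are absolute (independent of `q`, `χ`, `t`).

## References

* H. L. Montgomery, R. C. Vaughan, *Multiplicative Number Theory I. Classical Theory*, CUP 2007,
  (10.35), Lemmas 12.6, 12.7, 12.8, 12.9, Theorem 12.10. [MontgomeryVaughan2007]
-/

noncomputable section

open Complex Filter Topology Set Metric
open scoped Real

namespace Literature.NumberTheory.LFunctions

namespace ExplicitPsiChar

open DirichletCharacter Literature.NumberTheory.LFunctions.SiegelZero PsiOneExplicit

variable {q : ℕ} [NeZero q] {χ : DirichletCharacter ℂ q}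

/-! ### The Gamma factor: differentiability and logarithmic derivative off the poles -/

omit [NeZero q] in
/-- Off its zeros the Gamma factor `γ(·, χ)` is differentiable, and `γ'/γ(s, χ) = Γ_ℝ'/Γ_ℝ(s + a)`
with `a` the parity (`Γ_ℝ` is differentiable off its zeros, the tree's
`RealZeros.hasDerivAt_Gammaℝ`). [folklore] -/
theorem differentiableAt_gammaFactor_and_logDeriv (χ : DirichletCharacter ℂ q) {s : ℂ}
    (hs : gammaFactor χ s ≠ 0) :
    DifferentiableAt ℂ (gammaFactor χ) s ∧
      ∃ a : ℝ, (a = 0 ∨ a = 1) ∧ Gammaℝ (s + a) ≠ 0 ∧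
        logDeriv (gammaFactor χ) s = logDeriv Gammaℝ (s + a) := by
  have differentiableAt_Gammaℝ_of_ne_zero : ∀ {s : ℂ}, Gammaℝ s ≠ 0 →
      DifferentiableAt ℂ Gammaℝ s := by
    intro s hs
    have hpole : ∀ m : ℕ, s / 2 ≠ -m := by
      intro m h
      exact hs (Gammaℝ_eq_zero_iff.2 ⟨m, by linear_combination 2 * h⟩)
    exact (RealZeros.hasDerivAt_Gammaℝ hpole).differentiableAt
  rcases χ.even_or_odd with hχ | hχ
  · have hfun : gammaFactor χ = Gammaℝ := funext fun z ↦ hχ.gammaFactor_def z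
    rw [hfun] at hs ⊢
    exact ⟨differentiableAt_Gammaℝ_of_ne_zero hs, 0, Or.inl rfl, by simpa using hs, by simp⟩
  · have hfun : gammaFactor χ = Gammaℝ ∘ fun z ↦ z + 1 := funext fun z ↦ hχ.gammaFactor_def z
    rw [hχ.gammaFactor_def] at hs
    have hd : DifferentiableAt ℂ Gammaℝ (s + 1) := differentiableAt_Gammaℝ_of_ne_zero hs
    refine ⟨?_, 1, Or.inr rfl, by simpa using hs, ?_⟩
    · rw [hfun]; exact hd.comp s (differentiableAt_id.add_const 1)
    · rw [hfun, logDeriv_comp (by exact hd) (differentiableAt_id.add_const 1)]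
      simp

/-! ### `L'/L = Λ'/Λ − γ'/γ` -/

/-- `L'/L(s, χ) = Λ'/Λ(s, χ) − γ'/γ(s, χ)` wherever `Λ(s, χ) ≠ 0` and `γ(s, χ) ≠ 0` (`χ ≠ χ₀`).
[cite: MontgomeryVaughan2007, (10.35)] -/
theorem logDeriv_LFunction_eq (hχ : χ ≠ 1) {s : ℂ} (hΛ : completedLFunction χ s ≠ 0)
    (hG : gammaFactor χ s ≠ 0) :
    logDeriv χ.LFunction s = logDeriv (completedLFunction χ) s - logDeriv (gammaFactor χ) s := by
  have hfun : χ.LFunction = fun z ↦ completedLFunction χ z / gammaFactor χ z :=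
    funext fun z ↦ LFunction_eq_completed_div_gammaFactor χ z (Or.inr (level_ne_one hχ))
  rw [hfun, logDeriv_div s hΛ hG ((differentiable_completedLFunction hχ) s)
    (differentiableAt_gammaFactor_and_logDeriv χ hG).1]

/-! ### The logarithmic derivative of the functional equation -/

/-- **`Λ'/Λ(1 − s, χ) = −log q − Λ'/Λ(s, χ̄)`** for a primitive `χ ≠ χ₀`, at every `s` with
`Λ(s, χ̄) ≠ 0` (differentiate `Λ(1 − s, χ) = q^{s−1/2} ε(χ) Λ(s, χ̄)`).
[cite: MontgomeryVaughan2007, Corollary 10.8 and (10.35)] -/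
theorem logDeriv_completed_one_sub (hprim : χ.IsPrimitive) (hχ : χ ≠ 1) {s : ℂ}
    (hs : completedLFunction χ⁻¹ s ≠ 0) :
    logDeriv (completedLFunction χ) (1 - s) =
      -(Real.log q : ℂ) - logDeriv (completedLFunction χ⁻¹) s := by
  have hq0 : (q : ℂ) ≠ 0 := Nat.cast_ne_zero.2 (NeZero.ne q)
  have hε := rootNumber_ne_zero hprim hχ
  have hΛd : Differentiable ℂ (completedLFunction χ) := differentiable_completedLFunction hχ
  have hΛ'd : Differentiable ℂ (completedLFunction χ⁻¹) :=
    differentiable_completedLFunction (mt inv_eq_one.mp hχ)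
  -- the two descriptions of `F(z) = Λ(1 - z, χ)`
  set H : ℂ → ℂ := fun z ↦ (q : ℂ) ^ (z - 1 / 2) * χ.rootNumber with hH
  have hF : (completedLFunction χ ∘ fun z : ℂ ↦ 1 - z) = fun z ↦ H z * completedLFunction χ⁻¹ z := by
    funext z
    rw [Function.comp_apply, DirichletCharacter.IsPrimitive.completedLFunction_one_sub hprim z]
  have hHd : ∀ z, HasDerivAt H ((q : ℂ) ^ (z - 1 / 2) * Complex.log q * 1 * χ.rootNumber) z := by
    intro z
    exact (((hasDerivAt_id z).sub_const (1 / 2)).const_cpow (Or.inl hq0)).mul_const _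
  have hHz : H s ≠ 0 := by
    simp only [hH]
    refine mul_ne_zero ?_ hε
    rw [Ne, cpow_eq_zero_iff, not_and_or]
    exact Or.inl hq0
  have hlogH : logDeriv H s = Real.log q := by
    rw [logDeriv_apply, (hHd s).deriv]
    have hlog : Complex.log (q : ℂ) = ((Real.log q : ℝ) : ℂ) := by
      rw [show (q : ℂ) = ((q : ℝ) : ℂ) by norm_cast, Complex.ofReal_log (Nat.cast_nonneg q)]
    have hHz' : (q : ℂ) ^ (s - 1 / 2) * χ.rootNumber ≠ 0 := hHz
    rw [hlog, show (q : ℂ) ^ (s - 1 / 2) * ((Real.log q : ℝ) : ℂ) * 1 * χ.rootNumber =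
      ((Real.log q : ℝ) : ℂ) * ((q : ℂ) ^ (s - 1 / 2) * χ.rootNumber) by ring]
    simp only [hH]
    rw [mul_div_assoc, div_self hHz', mul_one]
  -- left: chain rule
  have h1 : logDeriv (completedLFunction χ ∘ fun z : ℂ ↦ 1 - z) s =
      -logDeriv (completedLFunction χ) (1 - s) := by
    rw [logDeriv_comp (by exact (hΛd (1 - s))) ((differentiableAt_const _).sub differentiableAt_id)]
    rw [deriv_const_sub, deriv_id'']
    ring
  -- right: product rule
  have h2 : logDeriv (fun z ↦ H z * completedLFunction χ⁻¹ z) s =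
      Real.log q + logDeriv (completedLFunction χ⁻¹) s := by
    rw [logDeriv_mul s hHz hs (hHd s).differentiableAt (hΛ'd s), hlogH]
  rw [hF] at h1
  rw [h1] at h2
  linear_combination -h2

/-- **Montgomery–Vaughan Lemma 12.8 / (10.35), the reflection formula for `L'/L`**: for a
primitive `χ ≠ χ₀` and `s` with `γ(s, χ) ≠ 0`, `γ(1 − s, χ) ≠ 0` and `L(1 − s, χ̄) ≠ 0`, we have
`L(s, χ) ≠ 0` and
`L'/L(s, χ) = −log q − L'/L(1 − s, χ̄) − γ'/γ(1 − s, χ) − γ'/γ(s, χ)`.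
[cite: MontgomeryVaughan2007, Lemma 12.8] -/
theorem logDeriv_LFunction_eq_reflect (hprim : χ.IsPrimitive) (hχ : χ ≠ 1) {s : ℂ}
    (hG : gammaFactor χ s ≠ 0) (hG1 : gammaFactor χ (1 - s) ≠ 0)
    (hL1 : χ⁻¹.LFunction (1 - s) ≠ 0) :
    χ.LFunction s ≠ 0 ∧
      logDeriv χ.LFunction s = -(Real.log q : ℂ) - logDeriv χ⁻¹.LFunction (1 - s) -
        logDeriv (gammaFactor χ) (1 - s) - logDeriv (gammaFactor χ) s := by
  have hχ' : χ⁻¹ ≠ 1 := mt inv_eq_one.mp hχ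
  have hq1 : q ≠ 1 := level_ne_one hχ
  have hq0 : (q : ℂ) ≠ 0 := Nat.cast_ne_zero.2 (NeZero.ne q)
  -- `Λ(1 - s, χ̄) ≠ 0`
  have hΛ1 : completedLFunction χ⁻¹ (1 - s) ≠ 0 := by
    intro h
    apply hL1
    rw [LFunction_eq_completed_div_gammaFactor χ⁻¹ (1 - s) (Or.inr hq1), h, zero_div]
  -- `Λ(s, χ) ≠ 0` by the functional equation
  have hΛ : completedLFunction χ s ≠ 0 := by
    rw [completedLFunction_eq_mul_one_sub hprim s]
    refine mul_ne_zero (mul_ne_zero ?_ (rootNumber_ne_zero hprim hχ)) hΛ1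
    rw [Ne, cpow_eq_zero_iff, not_and_or]; exact Or.inl hq0
  have hL : χ.LFunction s ≠ 0 := by
    rw [LFunction_eq_completed_div_gammaFactor χ s (Or.inr hq1)]
    exact div_ne_zero hΛ hG
  refine ⟨hL, ?_⟩
  have hG1' : gammaFactor χ⁻¹ (1 - s) ≠ 0 := by rwa [gammaFactor_inv]
  have e1 := logDeriv_LFunction_eq hχ hΛ hG
  have e2 := logDeriv_LFunction_eq hχ' hΛ1 hG1'
  have e3 := logDeriv_completed_one_sub hprim hχ (s := 1 - s) hΛ1
  rw [sub_sub_cancel] at e3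
  have e4 : logDeriv (gammaFactor χ⁻¹) (1 - s) = logDeriv (gammaFactor χ) (1 - s) := by
    have : gammaFactor χ⁻¹ = gammaFactor χ := funext fun z ↦ gammaFactor_inv χ z
    rw [this]
  rw [e4] at e2
  rw [e1, e3, e2]
  ring

/-! ### `L'/L` on `σ ≥ 3/2`: the Dirichlet series -/

omit [NeZero q] in
/-- The terms of `∑ χ(n)Λ(n) n^{-s}` are dominated by those of `∑ Λ(n) n^{-3/2}` on `σ ≥ 3/2`.
[folklore] -/
theorem norm_term_twist_le (χ : DirichletCharacter ℂ q) {s : ℂ} (hs : 3 / 2 ≤ s.re) (n : ℕ) :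
    ‖LSeries.term ((fun n : ℕ ↦ χ n) * fun n : ℕ ↦ (ArithmeticFunction.vonMangoldt n : ℂ)) s n‖ ≤
      ‖LSeries.term (fun n : ℕ ↦ (ArithmeticFunction.vonMangoldt n : ℂ)) (3 / 2 : ℂ) n‖ := by
  refine (LSeries.norm_term_le_of_re_le_re _ (s := (3 / 2 : ℂ)) (s' := s) (by simpa using hs) n).trans ?_
  rcases Nat.eq_zero_or_pos n with rfl | hn
  · simp [LSeries.term]
  · rw [LSeries.term_of_ne_zero hn.ne', LSeries.term_of_ne_zero hn.ne', norm_div, norm_div,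
      Pi.mul_apply, norm_mul]
    refine div_le_div_of_nonneg_right ?_ (norm_nonneg _)
    exact mul_le_of_le_one_left (norm_nonneg _) (χ.norm_le_one _)

/-- **`L'/L` on `σ ≥ 3/2`**: `‖L'/L(s, χ)‖ ≤ ∑ Λ(n) n^{-3/2}` and `L(s, χ) ≠ 0`
(`−L'/L(s, χ) = ∑ χ(n)Λ(n)n^{-s}`, Mathlib's `DirichletCharacter.LSeries_twist_vonMangoldt_eq`).
[cite: MontgomeryVaughan2007, Theorem 12.10 (proof)] -/
theorem norm_logDeriv_LFunction_le_of_re_ge (χ : DirichletCharacter ℂ q) {s : ℂ}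
    (hs : 3 / 2 ≤ s.re) :
    ‖logDeriv χ.LFunction s‖ ≤
      ∑' n : ℕ, ‖LSeries.term (fun n : ℕ ↦ (ArithmeticFunction.vonMangoldt n : ℂ)) (3 / 2 : ℂ) n‖ := by
  have hs1 : 1 < s.re := by linarith
  set f : ℕ → ℂ := (fun n : ℕ ↦ χ n) * fun n : ℕ ↦ (ArithmeticFunction.vonMangoldt n : ℂ) with hf
  have hsum3 : Summable fun n ↦ ‖LSeries.term (fun n : ℕ ↦ (ArithmeticFunction.vonMangoldt n : ℂ))
      (3 / 2 : ℂ) n‖ := by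
    have h := ArithmeticFunction.LSeriesSummable_vonMangoldt (s := (3 / 2 : ℂ)) (by norm_num)
    exact summable_norm_iff.mpr h
  have hle : ∀ n, ‖LSeries.term f s n‖ ≤
      ‖LSeries.term (fun n : ℕ ↦ (ArithmeticFunction.vonMangoldt n : ℂ)) (3 / 2 : ℂ) n‖ :=
    norm_term_twist_le χ hs
  have hsum : Summable fun n ↦ ‖LSeries.term f s n‖ :=
    Summable.of_nonneg_of_le (fun _ ↦ norm_nonneg _) hle hsum3
  -- `logDeriv L = -LSeries f` at `s`
  have hval : logDeriv χ.LFunction s = -LSeries f s := by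
    rw [logDeriv_apply, deriv_LFunction_eq_deriv_LSeries χ hs1, LFunction_eq_LSeries χ hs1, hf,
      DirichletCharacter.LSeries_twist_vonMangoldt_eq χ hs1]
    ring
  rw [hval, norm_neg]
  calc ‖LSeries f s‖ = ‖∑' n, LSeries.term f s n‖ := rfl
    _ ≤ ∑' n, ‖LSeries.term f s n‖ := norm_tsum_le_tsum_norm hsum
    _ ≤ _ := hsum.tsum_le_tsum hle hsum3

/-! ### `Γ_ℝ'/Γ_ℝ` on the lines of the contour -/

/-- **`|Γ_ℝ'/Γ_ℝ(σ + it)| ≤ log(|t| + 4)/2 + 6`** for `−1/2 ≤ σ ≤ 3`, `|t| ≥ 2`. [folklore] -/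
theorem norm_logDeriv_Gammaℝ_le_of_mem_Icc {σ t : ℝ} (hσ1 : -(1 / 2) ≤ σ) (hσ2 : σ ≤ 3)
    (ht : 2 ≤ |t|) : ‖logDeriv Gammaℝ (σ + t * I)‖ ≤ Real.log (|t| + 4) / 2 + 6 := by
  set s : ℂ := σ + t * I with hs
  have hsre : s.re = σ := by simp [hs]
  have hsim : s.im = t := by simp [hs]
  have h0 : s ≠ 0 := fun h ↦ by
    have := congrArg Complex.im h; rw [hsim] at this; simp at this; rw [this] at ht; norm_num at ht
  rw [logDeriv_Gammaℝ_eq_shift (by rw [hsre]; linarith) h0, ← Complex.ofReal_log Real.pi_pos.le]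
  set w : ℂ := s / 2 + 1 with hw
  have hwre : 0 < w.re := by simp [hw, hsre]; linarith
  have hwim : 1 / 2 ≤ |w.im| := by
    have : w.im = t / 2 := by simp [hw, hsim]
    rw [this, abs_div, abs_two]; linarith
  have hψ := Literature.Analysis.SpecialFunctions.Complex.norm_digamma_le_log hwre hwim
  have hwn : ‖w‖ ≤ |t| / 2 + 5 / 2 := by
    have h1 : ‖s‖ ≤ |σ| + |t| := by
      simpa [hs] using Complex.norm_le_abs_re_add_abs_im s
    have hσ' : |σ| ≤ 3 := abs_le.2 ⟨by linarith, hσ2⟩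
    calc ‖w‖ ≤ ‖s / 2‖ + ‖(1 : ℂ)‖ := norm_add_le _ _
      _ = ‖s‖ / 2 + 1 := by simp
      _ ≤ |t| / 2 + 5 / 2 := by linarith [abs_nonneg t]
  have hlog : Real.log (1 + ‖w‖) ≤ Real.log (|t| + 4) :=
    Real.log_le_log (by positivity) (by linarith [abs_nonneg t])
  have h1s : ‖1 / s‖ ≤ 1 / 2 := by
    rw [norm_div, norm_one]
    have : (2 : ℝ) ≤ ‖s‖ := ht.trans (by rw [← hsim]; exact Complex.abs_im_le_norm s)
    exact one_div_le_one_div_of_le two_pos this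
  have hπ : ‖(-(Real.log π : ℂ)) / 2‖ ≤ 1 := by
    rw [norm_div, norm_neg, Complex.norm_real, Real.norm_eq_abs, Complex.norm_two,
      abs_of_pos (Real.log_pos (by linarith [Real.pi_gt_three]))]
    linarith [log_pi_lt_two]
  calc ‖-(Real.log π : ℂ) / 2 + digamma w / 2 - 1 / s‖
      ≤ ‖-(Real.log π : ℂ) / 2‖ + ‖digamma w / 2‖ + ‖1 / s‖ := norm_sub_le_of_le (norm_add_le _ _) le_rfl
    _ ≤ 1 + (Real.log (|t| + 4) + 8) / 2 + 1 / 2 := by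
        gcongr
        rw [norm_div, Complex.norm_two]
        linarith
    _ ≤ Real.log (|t| + 4) / 2 + 6 := by linarith

omit [NeZero q] in
/-- The Gamma factor on the lines of the strip part: for `−1/2 ≤ σ ≤ 2`, `|t| ≥ 2`,
`|γ'/γ(σ + it, χ)| ≤ log(|t| + 4)/2 + 6` (`σ + a ∈ [−1/2, 3]`). [folklore] -/
theorem norm_logDeriv_gammaFactor_le (χ : DirichletCharacter ℂ q) {σ t : ℝ} (hσ1 : -(1 / 2) ≤ σ)
    (hσ2 : σ ≤ 2) (ht : 2 ≤ |t|) :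
    ‖logDeriv (gammaFactor χ) (σ + t * I)‖ ≤ Real.log (|t| + 4) / 2 + 6 := by
  have ht0 : t ≠ 0 := fun h ↦ by rw [h, abs_zero] at ht; linarith
  have hG : gammaFactor χ (σ + t * I) ≠ 0 := fun h ↦ by
    have := (im_eq_zero_of_gammaFactor_eq_zero χ h).1
    simp at this
    exact ht0 this
  obtain ⟨-, a, ha, -, hlog⟩ := differentiableAt_gammaFactor_and_logDeriv χ hG
  rw [hlog, show (σ : ℂ) + t * I + a = ((σ + a : ℝ) : ℂ) + t * I by push_cast; ring]
  refine norm_logDeriv_Gammaℝ_le_of_mem_Icc ?_ ?_ ht <;> rcases ha with rfl | rfl <;> linarith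

/-- `‖1/z‖ ≤ 1/|Re z|`. [folklore] -/
theorem norm_inv_le_inv_abs_re {z : ℂ} (hz : z.re ≠ 0) : ‖z⁻¹‖ ≤ 1 / |z.re| := by
  rw [norm_inv, ← one_div]
  exact one_div_le_one_div_of_le (abs_pos.2 hz) (Complex.abs_re_le_norm z)

/-- `log(1 + y) ≤ y` packaged as `log(A) ≤ A − 1` consequences: for `A ≥ 1`, `B ≥ 4`:
`log(A + B) ≤ A + log(B + ... )`; concretely `log(c − kσ + |t|)`-type bounds. We use:
for `u ≥ 1`, `v ≥ 0`: `log((u + v)/2 + 1) ≤ u + log(v + 4)`. [folklore] -/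
theorem log_half_add_le {u v : ℝ} (hu : 1 ≤ u) (hv : 0 ≤ v) :
    Real.log ((u + v) / 2 + 1) ≤ u + Real.log (v + 4) := by
  have h1 : (u + v) / 2 + 1 ≤ (u + 1) * (v + 4) := by nlinarith
  have h2 : Real.log ((u + v) / 2 + 1) ≤ Real.log ((u + 1) * (v + 4)) :=
    Real.log_le_log (by positivity) h1
  rw [Real.log_mul (by positivity) (by positivity)] at h2
  have h3 : Real.log (u + 1) ≤ u := by
    have := Real.log_le_sub_one_of_pos (by positivity : (0 : ℝ) < u + 1); linarith
  linarith

/-! ### `L'/L` in the left half-plane `σ ≤ −1/2`, `|t| ≥ 2` (Montgomery–Vaughan Lemma 12.9) -/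

/-- **Montgomery–Vaughan Lemma 12.9 (left half-plane, horizontal lines)**: there is an absolute
`A > 0` such that for every `q > 1`, every primitive `χ` mod `q`, every `σ ≤ −1/2` and `|t| ≥ 2`:
`‖L'/L(σ + it, χ)‖ ≤ A + log q + log(|t| + 4) + 5(−σ)`. (The source: `L'/L(s, χ) ≪ log(q|s|)`
off the trivial zeros; our linear term in `|σ|` comes from the crude shift of the digamma
function and is harmless against the weight `x^σ`.) [cite: MontgomeryVaughan2007, Lemma 12.9] -/
theorem exists_norm_logDeriv_LFunction_le_left :
    ∃ A : ℝ, 0 < A ∧ ∀ (q : ℕ) [NeZero q] (χ : DirichletCharacter ℂ q), χ.IsPrimitive → 1 < q →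
      ∀ σ t : ℝ, σ ≤ -(1 / 2) → 2 ≤ |t| →
        χ.LFunction (σ + t * I) ≠ 0 ∧
          ‖logDeriv χ.LFunction (σ + t * I)‖ ≤
            A + Real.log q + Real.log (|t| + 4) + 5 * (-σ) := by
  set M₀ : ℝ := ∑' n : ℕ, ‖LSeries.term (fun n : ℕ ↦ (ArithmeticFunction.vonMangoldt n : ℂ))
    (3 / 2 : ℂ) n‖ with hM₀
  have hM₀0 : 0 ≤ M₀ := tsum_nonneg fun _ ↦ norm_nonneg _
  refine ⟨M₀ + 16, by positivity, fun q _ χ hprim hq σ t hσ ht ↦ ?_⟩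
  have hχ : χ ≠ 1 := ne_one_of_isPrimitive hprim hq
  have hχ' : χ⁻¹ ≠ 1 := mt inv_eq_one.mp hχ
  have ht0 : t ≠ 0 := fun h ↦ by rw [h, abs_zero] at ht; linarith
  set s : ℂ := σ + t * I with hs
  have hsre : s.re = σ := by simp [hs]
  have hsim : s.im = t := by simp [hs]
  -- non-vanishing of the Gamma factors (off the real axis) and of `L(1 - s, χ̄)` (`Re ≥ 3/2`)
  have hG : gammaFactor χ s ≠ 0 := fun h ↦ by
    have := (im_eq_zero_of_gammaFactor_eq_zero χ h).1
    rw [hsim] at this; exact ht0 this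
  have hG1 : gammaFactor χ (1 - s) ≠ 0 := fun h ↦ by
    have := (im_eq_zero_of_gammaFactor_eq_zero χ h).1
    exact ht0 (by simpa [hsim] using this)
  have h1s : (1 - s).re = 1 - σ := by simp [hsre]
  have hL1 : χ⁻¹.LFunction (1 - s) ≠ 0 :=
    LFunction_ne_zero_of_one_le_re χ⁻¹ (Or.inl hχ') (by rw [h1s]; linarith)
  obtain ⟨hL, hrefl⟩ := logDeriv_LFunction_eq_reflect hprim hχ hG hG1 hL1
  refine ⟨hL, ?_⟩
  rw [hrefl]
  -- the four terms
  have hq1 : (1 : ℝ) ≤ q := by exact_mod_cast NeZero.one_le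
  have hlogq : ‖(-(Real.log q : ℂ))‖ = Real.log q := by
    rw [norm_neg, Complex.norm_real, Real.norm_eq_abs, abs_of_nonneg (Real.log_nonneg hq1)]
  have hT0 : ‖logDeriv χ⁻¹.LFunction (1 - s)‖ ≤ M₀ :=
    norm_logDeriv_LFunction_le_of_re_ge χ⁻¹ (by rw [h1s]; linarith)
  have hlog4 : 0 ≤ Real.log (|t| + 4) := Real.log_nonneg (by linarith [abs_nonneg t])
  have hπ : ‖(-(Complex.log π)) / 2‖ ≤ 1 := by
    rw [← Complex.ofReal_log Real.pi_pos.le, norm_div, norm_neg, Complex.norm_real,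
      Real.norm_eq_abs, Complex.norm_two, abs_of_pos (Real.log_pos (by linarith [Real.pi_gt_three]))]
    linarith [log_pi_lt_two]
  -- `γ'/γ(1 - s)`: digamma at a point with `Re ≥ 3/4`, `|Im| ≥ 1`
  have hT1 : ‖logDeriv (gammaFactor χ) (1 - s)‖ ≤ 7 + (-σ) / 2 + Real.log (|t| + 4) / 2 := by
    obtain ⟨-, a, ha, hGa, hlog⟩ := differentiableAt_gammaFactor_and_logDeriv χ hG1
    have ha0 : 0 ≤ a ∧ a ≤ 1 := by rcases ha with rfl | rfl <;> norm_num
    rw [hlog]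
    set w : ℂ := (1 - s + a) / 2 with hw
    have hpole : ∀ m : ℕ, (1 - s + (a : ℂ)) / 2 ≠ -m := by
      intro m h
      have := congrArg Complex.im h
      exact ht0 (by simpa [hsim] using this)
    rw [logDeriv_Gammaℝ hpole]
    have hwre : 0 < w.re := by simp [hw, hsre]; linarith
    have hwim : 1 / 2 ≤ |w.im| := by
      have : w.im = -t / 2 := by simp [hw, hsim]
      rw [this, abs_div, abs_neg, abs_two]; linarith
    have hψ := Literature.Analysis.SpecialFunctions.Complex.norm_digamma_le_log hwre hwim
    have hwn : ‖w‖ ≤ ((2 - σ) + |t|) / 2 := by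
      have h1 : ‖w‖ ≤ |w.re| + |w.im| := Complex.norm_le_abs_re_add_abs_im w
      have h2 : w.re = (1 - σ + a) / 2 := by simp [hw, hsre]
      have h3 : w.im = -t / 2 := by simp [hw, hsim]
      rw [h2, h3, abs_of_pos (by linarith), abs_div, abs_neg, abs_two] at h1
      linarith
    have hlog1 : Real.log (1 + ‖w‖) ≤ (2 - σ) + Real.log (|t| + 4) := by
      have := log_half_add_le (u := 2 - σ) (v := |t|) (by linarith) (abs_nonneg t)
      refine le_trans (Real.log_le_log (by positivity) ?_) this
      linarith
    calc ‖-Complex.log π / 2 + digamma ((1 - s + (a : ℂ)) / 2) / 2‖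
        ≤ ‖-Complex.log π / 2‖ + ‖digamma ((1 - s + (a : ℂ)) / 2) / 2‖ := norm_add_le _ _
      _ ≤ 1 + (Real.log (1 + ‖w‖) + 8) / 2 := by
          gcongr
          · rw [norm_div, Complex.norm_two]; exact div_le_div_of_nonneg_right hψ zero_le_two
      _ ≤ 7 + (-σ) / 2 + Real.log (|t| + 4) / 2 := by linarith
  -- `γ'/γ(s)`: digamma at a point with `Re ≤ 1/4`, `|Im| ≥ 1`: shift to the right
  have hT2 : ‖logDeriv (gammaFactor χ) s‖ ≤ 9 + 5 / 4 * (-σ) + Real.log (|t| + 4) / 2 := by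
    obtain ⟨-, a, ha, hGa, hlog⟩ := differentiableAt_gammaFactor_and_logDeriv χ hG
    have ha0 : 0 ≤ a ∧ a ≤ 1 := by rcases ha with rfl | rfl <;> norm_num
    rw [hlog]
    set w : ℂ := (s + a) / 2 with hw
    have hpole : ∀ m : ℕ, (s + (a : ℂ)) / 2 ≠ -m := by
      intro m h
      have := congrArg Complex.im h
      exact ht0 (by simpa [hsim] using this)
    rw [logDeriv_Gammaℝ hpole]
    -- the shift parameter
    set K : ℕ := ⌈-σ / 2⌉₊ with hK
    have hσ2 : 0 ≤ -σ / 2 := by linarith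
    have hK1 : -σ / 2 ≤ K := Nat.le_ceil _
    have hK2 : (K : ℝ) < -σ / 2 + 1 := Nat.ceil_lt_add_one hσ2
    have hwre : -(K : ℝ) - 1 / 4 ≤ w.re := by
      have : w.re = (σ + a) / 2 := by simp [hw, hsre]
      rw [this]; linarith
    have hwim : 1 ≤ |w.im| := by
      have : w.im = t / 2 := by simp [hw, hsim]
      rw [this, abs_div, abs_two]; linarith
    have hψ := norm_digamma_le_of_im_ge_one hwre hwim
    have hwn : ‖w + ((K + 1 : ℕ) : ℂ)‖ ≤ ((5 - 2 * σ) + |t|) / 2 := by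
      have h1 : ‖w‖ ≤ |w.re| + |w.im| := Complex.norm_le_abs_re_add_abs_im w
      have h2 : w.re = (σ + a) / 2 := by simp [hw, hsre]
      have h3 : w.im = t / 2 := by simp [hw, hsim]
      have h4 : |w.re| ≤ (1 - σ) / 2 := by
        rw [h2, abs_le]; constructor <;> linarith
      rw [h3, abs_div, abs_two] at h1
      have hKn : ‖((K + 1 : ℕ) : ℂ)‖ = (K : ℝ) + 1 := by rw [Complex.norm_natCast]; push_cast; ring
      calc ‖w + ((K + 1 : ℕ) : ℂ)‖ ≤ ‖w‖ + ‖((K + 1 : ℕ) : ℂ)‖ := norm_add_le _ _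
        _ ≤ ((1 - σ) / 2 + |t| / 2) + ((K : ℝ) + 1) := by rw [hKn]; linarith
        _ ≤ ((5 - 2 * σ) + |t|) / 2 := by linarith
    have hlog1 : Real.log (1 + ‖w + ((K + 1 : ℕ) : ℂ)‖) ≤ (5 - 2 * σ) + Real.log (|t| + 4) := by
      have := log_half_add_le (u := 5 - 2 * σ) (v := |t|) (by linarith) (abs_nonneg t)
      refine le_trans (Real.log_le_log (by positivity) ?_) this
      linarith
    calc ‖-Complex.log π / 2 + digamma ((s + (a : ℂ)) / 2) / 2‖
        ≤ ‖-Complex.log π / 2‖ + ‖digamma ((s + (a : ℂ)) / 2) / 2‖ := norm_add_le _ _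
      _ ≤ 1 + (Real.log (1 + ‖w + ((K + 1 : ℕ) : ℂ)‖) + 8 + (K + 1)) / 2 := by
          gcongr
          · rw [norm_div, Complex.norm_two]; exact div_le_div_of_nonneg_right hψ zero_le_two
      _ ≤ 9 + 5 / 4 * (-σ) + Real.log (|t| + 4) / 2 := by linarith
  calc ‖-(Real.log q : ℂ) - logDeriv χ⁻¹.LFunction (1 - s) - logDeriv (gammaFactor χ) (1 - s) -
        logDeriv (gammaFactor χ) s‖
      ≤ ‖-(Real.log q : ℂ)‖ + ‖logDeriv χ⁻¹.LFunction (1 - s)‖ +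
          ‖logDeriv (gammaFactor χ) (1 - s)‖ + ‖logDeriv (gammaFactor χ) s‖ := by
        refine (norm_sub_le _ _).trans ?_
        gcongr
        refine (norm_sub_le _ _).trans ?_
        gcongr
        exact norm_sub_le _ _
    _ ≤ Real.log q + M₀ + (7 + (-σ) / 2 + Real.log (|t| + 4) / 2) +
          (9 + 5 / 4 * (-σ) + Real.log (|t| + 4) / 2) := by rw [hlogq]; gcongr
    _ ≤ M₀ + 16 + Real.log q + Real.log (|t| + 4) + 5 * (-σ) := by linarith

/-! ### `L'/L` on the far-left lines `σ = −2K − 1/2`, all `t` -/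

/-- **`L'/L` on the far-left line `Re s = −2K − 1/2`** (`K ≥ 1`, all `t`): there is an absolute
`A > 0` with `‖L'/L(−2K − 1/2 + it, χ)‖ ≤ A + log q + 6K + 2|t|` for every `q > 1` and every
primitive `χ` mod `q` (reflection formula; the digamma terms are shifted to `Re ≥ 3/4` and bounded
linearly). [cite: MontgomeryVaughan2007, Lemma 12.9] -/
theorem exists_norm_logDeriv_LFunction_farLeft_le :
    ∃ A : ℝ, 0 < A ∧ ∀ (q : ℕ) [NeZero q] (χ : DirichletCharacter ℂ q), χ.IsPrimitive → 1 < q →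
      ∀ (K : ℕ), 1 ≤ K → ∀ t : ℝ,
        χ.LFunction ((((-(2 * (K : ℝ)) - 1 / 2 : ℝ)) : ℂ) + t * I) ≠ 0 ∧
          ‖logDeriv χ.LFunction ((((-(2 * (K : ℝ)) - 1 / 2 : ℝ)) : ℂ) + t * I)‖ ≤
            A + Real.log q + 6 * K + 2 * |t| := by
  set M₀ : ℝ := ∑' n : ℕ, ‖LSeries.term (fun n : ℕ ↦ (ArithmeticFunction.vonMangoldt n : ℂ))
    (3 / 2 : ℂ) n‖ with hM₀
  have hM₀0 : 0 ≤ M₀ := tsum_nonneg fun _ ↦ norm_nonneg _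
  refine ⟨M₀ + 8, by positivity, fun q _ χ hprim hq K hK t ↦ ?_⟩
  have hχ : χ ≠ 1 := ne_one_of_isPrimitive hprim hq
  have hχ' : χ⁻¹ ≠ 1 := mt inv_eq_one.mp hχ
  have hK1 : (1 : ℝ) ≤ K := by exact_mod_cast hK
  set σ : ℝ := -(2 * (K : ℝ)) - 1 / 2 with hσ
  set s : ℂ := (σ : ℂ) + t * I with hs
  have hsre : s.re = σ := by simp [hs]
  have hsim : s.im = t := by simp [hs]
  -- non-vanishing of the Gamma factors and of `L(1 - s, χ̄)`
  have hG : gammaFactor χ s ≠ 0 := by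
    refine gammaFactor_ne_zero_of_not_int χ fun m h ↦ ?_
    rw [hsre, hσ] at h
    have h2 : (4 : ℝ) * (-(m : ℝ) - 2 * K) = 2 := by linarith
    have h3 : (4 * (-(m : ℤ) - 2 * K) : ℤ) = 2 := by exact_mod_cast h2
    omega
  have h1s : (1 - s).re = 1 - σ := by simp [hsre]
  have hG1 : gammaFactor χ (1 - s) ≠ 0 :=
    gammaFactor_ne_zero_of_re_pos χ (by rw [h1s, hσ]; linarith)
  have hL1 : χ⁻¹.LFunction (1 - s) ≠ 0 :=
    LFunction_ne_zero_of_one_le_re χ⁻¹ (Or.inl hχ') (by rw [h1s, hσ]; linarith)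
  obtain ⟨hL, hrefl⟩ := logDeriv_LFunction_eq_reflect hprim hχ hG hG1 hL1
  refine ⟨hL, ?_⟩
  rw [hrefl]
  have hq1 : (1 : ℝ) ≤ q := by exact_mod_cast NeZero.one_le
  have hlogq : ‖(-(Real.log q : ℂ))‖ = Real.log q := by
    rw [norm_neg, Complex.norm_real, Real.norm_eq_abs, abs_of_nonneg (Real.log_nonneg hq1)]
  have hT0 : ‖logDeriv χ⁻¹.LFunction (1 - s)‖ ≤ M₀ :=
    norm_logDeriv_LFunction_le_of_re_ge χ⁻¹ (by rw [h1s, hσ]; linarith)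
  have hπ : ‖(-(Complex.log π)) / 2‖ ≤ 1 := by
    rw [← Complex.ofReal_log Real.pi_pos.le, norm_div, norm_neg, Complex.norm_real,
      Real.norm_eq_abs, Complex.norm_two, abs_of_pos (Real.log_pos (by linarith [Real.pi_gt_three]))]
    linarith [log_pi_lt_two]
  -- `γ'/γ(1 - s)`: `Re ≥ 3/4`, linear digamma bound
  have hT1 : ‖logDeriv (gammaFactor χ) (1 - s)‖ ≤ 4 + 3 / 2 * K + 3 / 4 * |t| := by
    obtain ⟨-, a, ha, hGa, hlog⟩ := differentiableAt_gammaFactor_and_logDeriv χ hG1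
    have ha0 : 0 ≤ a ∧ a ≤ 1 := by rcases ha with rfl | rfl <;> norm_num
    rw [hlog]
    set w : ℂ := (1 - s + a) / 2 with hw
    have hwre : w.re = (1 - σ + a) / 2 := by simp [hw, hsre]
    have hwim : w.im = -t / 2 := by simp [hw, hsim]
    have hpole : ∀ m : ℕ, (1 - s + (a : ℂ)) / 2 ≠ -m := by
      intro m h
      have := congrArg Complex.re h
      rw [show ((1 - s + (a : ℂ)) / 2).re = w.re from rfl, hwre] at this
      simp at this
      rw [hσ] at this
      linarith [(m.cast_nonneg : (0 : ℝ) ≤ m)]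
    rw [logDeriv_Gammaℝ hpole]
    have hψ := ZetaZeroSum.norm_digamma_le_linear (w := w) (by rw [hwre, hσ]; linarith)
    have hw1 : ‖w - 1‖ ≤ (K + 5 / 4) + |t| / 2 := by
      have h1 : ‖w - 1‖ ≤ |(w - 1).re| + |(w - 1).im| := Complex.norm_le_abs_re_add_abs_im _
      have h2 : (w - 1).re = (1 - σ + a) / 2 - 1 := by simp [hwre]
      have h3 : (w - 1).im = -t / 2 := by simp [hwim]
      rw [h2, h3, abs_div, abs_neg, abs_two] at h1
      have h4 : |(1 - σ + a) / 2 - 1| ≤ K + 5 / 4 := by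
        rw [hσ, abs_le]; constructor <;> linarith
      linarith
    calc ‖-Complex.log π / 2 + digamma ((1 - s + (a : ℂ)) / 2) / 2‖
        ≤ ‖-Complex.log π / 2‖ + ‖digamma ((1 - s + (a : ℂ)) / 2) / 2‖ := norm_add_le _ _
      _ ≤ 1 + (1 + 3 * ((K + 5 / 4) + |t| / 2)) / 2 := by
          gcongr
          · rw [norm_div, Complex.norm_two]
            exact div_le_div_of_nonneg_right (hψ.trans (by linarith)) zero_le_two
      _ ≤ 4 + 3 / 2 * K + 3 / 4 * |t| := by linarith
  -- `γ'/γ(s)`: shift by `K + 1` to `Re ≥ 3/4`, linear digamma bound, `K + 1` terms `≤ 4`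
  have hT2 : ‖logDeriv (gammaFactor χ) s‖ ≤ 4 + 2 * K + 3 / 4 * |t| := by
    obtain ⟨-, a, ha, hGa, hlog⟩ := differentiableAt_gammaFactor_and_logDeriv χ hG
    have ha0 : 0 ≤ a ∧ a ≤ 1 := by rcases ha with rfl | rfl <;> norm_num
    rw [hlog]
    set w : ℂ := (s + a) / 2 with hw
    have hwre : w.re = (σ + a) / 2 := by simp [hw, hsre]
    have hwim : w.im = t / 2 := by simp [hw, hsim]
    -- `Re (w + j)` is never an integer: it is `-K - 1/4 + a/2 + j`
    have hnotint : ∀ (j : ℕ) (m : ℤ), (w + j).re ≠ m := by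
      intro j m h
      simp only [add_re, natCast_re, hwre, hσ] at h
      rcases ha with rfl | rfl
      · have h2 : (4 : ℝ) * ((m : ℝ) - j + K) = -1 := by linarith
        have h3 : (4 * ((m : ℤ) - j + K) : ℤ) = -1 := by exact_mod_cast h2
        omega
      · have h2 : (4 : ℝ) * ((m : ℝ) - j + K) = 1 := by linarith
        have h3 : (4 * ((m : ℤ) - j + K) : ℤ) = 1 := by exact_mod_cast h2
        omega
    have hpole : ∀ m : ℕ, (s + (a : ℂ)) / 2 ≠ -m := by
      intro m h
      have := hnotint 0 (-(m : ℤ))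
      apply this
      rw [Nat.cast_zero, add_zero, show (s + (a : ℂ)) / 2 = w from rfl] at *
      rw [h]; simp
    rw [logDeriv_Gammaℝ hpole]
    have hw0 : ∀ k : ℕ, w ≠ -k := by
      intro k h
      apply hnotint 0 (-(k : ℤ))
      rw [Nat.cast_zero, add_zero, h]; simp
    have hshift := norm_digamma_le_shift hw0 (K + 1)
    -- the shifted point has `Re = 3/4 + a/2 ≥ 3/4`
    have hre' : (w + ((K + 1 : ℕ) : ℂ)).re = 3 / 4 + a / 2 := by
      simp [hwre, hσ]; ring
    have hψ := ZetaZeroSum.norm_digamma_le_linear (w := w + ((K + 1 : ℕ) : ℂ)) (by rw [hre']; linarith)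
    have hw1 : ‖w + ((K + 1 : ℕ) : ℂ) - 1‖ ≤ 1 / 4 + |t| / 2 := by
      have h1 := Complex.norm_le_abs_re_add_abs_im (w + ((K + 1 : ℕ) : ℂ) - 1)
      have h2 : (w + ((K + 1 : ℕ) : ℂ) - 1).re = 3 / 4 + a / 2 - 1 := by
        rw [sub_re, hre', one_re]
      have h3 : (w + ((K + 1 : ℕ) : ℂ) - 1).im = t / 2 := by simp [hwim]
      rw [h2, h3, abs_div, abs_two] at h1
      have h4 : |3 / 4 + a / 2 - 1| ≤ 1 / 4 := by rw [abs_le]; constructor <;> linarith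
      linarith
    -- the shift terms
    have hterms : ∑ j ∈ Finset.range (K + 1), ‖(w + (j : ℂ))⁻¹‖ ≤ 4 * ((K : ℝ) + 1) := by
      have hterm : ∀ j ∈ Finset.range (K + 1), ‖(w + (j : ℂ))⁻¹‖ ≤ 4 := by
        intro j hj
        rw [Finset.mem_range] at hj
        have hjK : (j : ℝ) ≤ K := by exact_mod_cast Nat.lt_succ_iff.1 hj
        have hrej : (w + (j : ℂ)).re = -(K : ℝ) - 1 / 4 + a / 2 + j := by
          simp [hwre, hσ]; ring
        have hne : (w + (j : ℂ)).re ≠ 0 := by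
          have := hnotint j 0; simpa using this
        refine (norm_inv_le_inv_abs_re hne).trans ?_
        rw [div_le_iff₀ (abs_pos.2 hne)]
        -- `|Re| ≥ 1/4`
        have hquarter : 1 / 4 ≤ |(w + (j : ℂ)).re| := by
          rw [hrej]
          rcases ha with rfl | rfl
          · -- `-(K - j) - 1/4 ≤ -1/4`
            rw [abs_of_neg (by linarith)]; linarith
          · -- `-(K - j) + 1/4`: either `j = K` (value `1/4`) or `≤ -3/4`
            rcases eq_or_lt_of_le hjK with h | h
            · rw [h, show -(K : ℝ) - 1 / 4 + 1 / 2 + K = 1 / 4 by ring]; norm_num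
            · have : (j : ℝ) + 1 ≤ K := by exact_mod_cast (show j + 1 ≤ K by exact_mod_cast h)
              rw [abs_of_neg (by linarith)]; linarith
        linarith
      calc ∑ j ∈ Finset.range (K + 1), ‖(w + (j : ℂ))⁻¹‖ ≤ ∑ j ∈ Finset.range (K + 1), (4 : ℝ) :=
            Finset.sum_le_sum hterm
        _ = 4 * ((K : ℝ) + 1) := by simp; ring
    have hψw : ‖digamma w‖ ≤ 7 / 4 + 3 / 2 * |t| + 4 * ((K : ℝ) + 1) := by
      refine hshift.trans ?_
      have : ‖digamma (w + ((K + 1 : ℕ) : ℂ))‖ ≤ 7 / 4 + 3 / 2 * |t| := hψ.trans (by linarith)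
      linarith
    calc ‖-Complex.log π / 2 + digamma ((s + (a : ℂ)) / 2) / 2‖
        ≤ ‖-Complex.log π / 2‖ + ‖digamma ((s + (a : ℂ)) / 2) / 2‖ := norm_add_le _ _
      _ ≤ 1 + (7 / 4 + 3 / 2 * |t| + 4 * ((K : ℝ) + 1)) / 2 := by
          gcongr
          · rw [norm_div, Complex.norm_two]
            exact div_le_div_of_nonneg_right hψw zero_le_two
      _ ≤ 4 + 2 * K + 3 / 4 * |t| := by linarith
  calc ‖-(Real.log q : ℂ) - logDeriv χ⁻¹.LFunction (1 - s) - logDeriv (gammaFactor χ) (1 - s) -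
        logDeriv (gammaFactor χ) s‖
      ≤ ‖-(Real.log q : ℂ)‖ + ‖logDeriv χ⁻¹.LFunction (1 - s)‖ +
          ‖logDeriv (gammaFactor χ) (1 - s)‖ + ‖logDeriv (gammaFactor χ) s‖ := by
        refine (norm_sub_le _ _).trans ?_
        gcongr
        refine (norm_sub_le _ _).trans ?_
        gcongr
        exact norm_sub_le _ _
    _ ≤ Real.log q + M₀ + (4 + 3 / 2 * K + 3 / 4 * |t|) + (4 + 2 * K + 3 / 4 * |t|) := by
        rw [hlogq]; gcongr
    _ ≤ M₀ + 8 + Real.log q + 6 * K + 2 * |t| := by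
        have : (0 : ℝ) ≤ |t| := abs_nonneg t
        nlinarith

/-! ### `L'/L` on the strip `−1/2 ≤ σ ≤ 3/2` at a good height (Montgomery–Vaughan Lemmas 12.6–12.7) -/

/-- **`L'/L` at a good height** (MV Lemmas 12.6–12.7): there is an absolute `C > 0` such that for
every `q > 1`, every primitive `χ` mod `q`, every `|t| ≥ 2` and `0 < η ≤ 1` such that every zero
`ρ` of `L(s, χ)` with `0 < Re ρ < 1` has `|Im ρ − t| ≥ η`, and every `−1/2 ≤ σ ≤ 3/2`:
`L(σ + it, χ) ≠ 0` and `‖L'/L(σ + it, χ)‖ ≤ C (log q + log(|t| + 4))/η`. On `σ ≥ 1/2` this is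
the disc partial fraction `L'/L = ∑_ρ m(ρ)/(s − ρ) + O(ℒ)` with `|s − ρ| ≥ η` and `∑ m(ρ) ≪ ℒ`;
on `σ < 1/2` the reflection formula moves the point to `1 − σ ∈ (1/2, 3/2]` for `χ̄` at height
`−t`, whose zeros are the `1 − ρ`. [cite: MontgomeryVaughan2007, Lemma 12.7] -/
theorem exists_norm_logDeriv_LFunction_le_strip :
    ∃ C : ℝ, 0 < C ∧ ∀ (q : ℕ) [NeZero q] (χ : DirichletCharacter ℂ q), χ.IsPrimitive → 1 < q →
      ∀ t η : ℝ, 2 ≤ |t| → 0 < η → η ≤ 1 →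
        (∀ ρ : ℂ, χ.LFunction ρ = 0 → 0 < ρ.re → ρ.re < 1 → η ≤ |ρ.im - t|) →
        ∀ σ : ℝ, σ ∈ Icc (-(1 / 2) : ℝ) (3 / 2) →
          χ.LFunction (σ + t * I) ≠ 0 ∧
            ‖logDeriv χ.LFunction (σ + t * I)‖ ≤ C * (Real.log q + Real.log (|t| + 4)) / η := by
  obtain ⟨C, hC0, hC⟩ := DirichletDisc.exists_norm_logDeriv_le_of_dist
  refine ⟨2 * C + 13, by positivity, fun q _ χ hprim hq t η ht hη hη1 hZ σ hσ ↦ ?_⟩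
  have hχ : χ ≠ 1 := ne_one_of_isPrimitive hprim hq
  have hχ' : χ⁻¹ ≠ 1 := mt inv_eq_one.mp hχ
  have ht0 : t ≠ 0 := fun h ↦ by rw [h, abs_zero] at ht; linarith
  set ℒ : ℝ := Real.log q + Real.log (|t| + 4) with hℒ
  have hℒ1 : 1 ≤ ℒ := DirichletZFR.one_le_ell q t
  have hq1 : (1 : ℝ) ≤ q := by exact_mod_cast NeZero.one_le
  have hlogq : 0 ≤ Real.log q := Real.log_nonneg hq1
  have hlog4 : 0 ≤ Real.log (|t| + 4) := Real.log_nonneg (by linarith [abs_nonneg t])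
  have hη' : 1 + 1 / η ≤ 2 / η := by
    rw [le_div_iff₀ hη, add_mul, one_mul, div_mul_cancel₀ _ hη.ne']
    linarith
  -- the bound `C(1 + 1/η)ℒ ≤ 2Cℒ/η`
  have hCη : C * (1 + 1 / η) * ℒ ≤ 2 * C * ℒ / η := by
    have h := mul_le_mul_of_nonneg_left hη' hC0.le
    have hℒ0 : 0 ≤ ℒ := by linarith
    calc C * (1 + 1 / η) * ℒ ≤ C * (2 / η) * ℒ := mul_le_mul_of_nonneg_right h hℒ0
      _ = 2 * C * ℒ / η := by ring
  rcases le_or_gt (1 / 2 : ℝ) σ with hσ2 | hσ2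
  · -- `σ ≥ 1/2`: the disc of `χ` at height `t`
    have hmem : (σ : ℂ) + t * I ∈ closedBall (2 + (t : ℂ) * I) (38 / 25) :=
      DirichletDisc.mem_closedBall_of_re_mem_Icc ⟨hσ2, by linarith [hσ.2]⟩ (by simp)
    have hdist : ∀ ρ ∈ DirichletDisc.discZeros χ t, η ≤ ‖(σ : ℂ) + t * I - ρ‖ := by
      intro ρ hρ
      obtain ⟨h0, -, hre, hre1, -⟩ := DirichletDisc.discZeros_prop hχ hρ
      have h := hZ ρ h0 (by linarith) hre1
      calc η ≤ |ρ.im - t| := h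
        _ = |((σ : ℂ) + t * I - ρ).im| := by rw [abs_sub_comm]; simp
        _ ≤ ‖(σ : ℂ) + t * I - ρ‖ := Complex.abs_im_le_norm _
    obtain ⟨hL, hb⟩ := hC q χ hχ t _ hmem η hη hdist
    refine ⟨hL, hb.trans ?_⟩
    calc C * (1 + 1 / η) * ℒ ≤ 2 * C * ℒ / η := hCη
      _ ≤ (2 * C + 13) * ℒ / η := by gcongr; linarith
  · -- `σ < 1/2`: reflect to `1 - σ ∈ (1/2, 3/2]` for `χ⁻¹` at height `-t`
    set s : ℂ := (σ : ℂ) + t * I with hs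
    have hsim : s.im = t := by simp [hs]
    have hsre : s.re = σ := by simp [hs]
    have h1s : 1 - s = ((1 - σ : ℝ) : ℂ) + ((-t : ℝ) : ℂ) * I := by
      simp only [hs]; push_cast; ring
    have hmem : 1 - s ∈ closedBall (2 + ((-t : ℝ) : ℂ) * I) (38 / 25) := by
      rw [h1s]
      exact DirichletDisc.mem_closedBall_of_re_mem_Icc ⟨by linarith, by linarith [hσ.1]⟩ (by simp)
    have hdist : ∀ u ∈ DirichletDisc.discZeros χ⁻¹ (-t), η ≤ ‖(1 - s) - u‖ := by
      intro u hu
      obtain ⟨h0, -, hre, hre1, -⟩ := DirichletDisc.discZeros_prop hχ' hu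
      have hre0 : 0 < u.re := by linarith
      -- `1 - u` is a zero of `χ` in the strip with ordinate `-Im u`
      have hz : χ.LFunction (1 - u) = 0 := (LFunction_one_sub_eq_zero_iff hprim hχ hre0 hre1).2 h0
      have h := hZ (1 - u) hz (by simp; linarith) (by simp; linarith)
      simp only [sub_im, one_im, zero_sub] at h
      calc η ≤ |-u.im - t| := h
        _ = |((1 - s) - u).im| := by rw [show -u.im - t = -t - u.im by ring]; simp [hsim]
        _ ≤ ‖(1 - s) - u‖ := Complex.abs_im_le_norm _
    obtain ⟨hL1, hb1⟩ := hC q χ⁻¹ hχ' (-t) _ hmem η hη hdist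
    rw [abs_neg] at hb1
    -- Gamma factors
    have hG : gammaFactor χ s ≠ 0 := fun h ↦ by
      have := (im_eq_zero_of_gammaFactor_eq_zero χ h).1
      rw [hsim] at this; exact ht0 this
    have hG1 : gammaFactor χ (1 - s) ≠ 0 := fun h ↦ by
      have := (im_eq_zero_of_gammaFactor_eq_zero χ h).1
      exact ht0 (by simpa [hsim] using this)
    obtain ⟨hL, hrefl⟩ := logDeriv_LFunction_eq_reflect hprim hχ hG hG1 hL1
    refine ⟨hL, ?_⟩
    rw [hrefl]
    have hlogqn : ‖(-(Real.log q : ℂ))‖ = Real.log q := by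
      rw [norm_neg, Complex.norm_real, Real.norm_eq_abs, abs_of_nonneg hlogq]
    have hΓ1 : ‖logDeriv (gammaFactor χ) (1 - s)‖ ≤ Real.log (|t| + 4) / 2 + 6 := by
      rw [h1s]
      have := norm_logDeriv_gammaFactor_le χ (σ := 1 - σ) (t := -t) (by linarith)
        (by linarith [hσ.1]) (by rwa [abs_neg])
      rwa [abs_neg] at this
    have hΓ2 : ‖logDeriv (gammaFactor χ) s‖ ≤ Real.log (|t| + 4) / 2 + 6 :=
      norm_logDeriv_gammaFactor_le χ hσ.1 (by linarith [hσ.2]) ht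
    calc ‖-(Real.log q : ℂ) - logDeriv χ⁻¹.LFunction (1 - s) - logDeriv (gammaFactor χ) (1 - s) -
          logDeriv (gammaFactor χ) s‖
        ≤ ‖-(Real.log q : ℂ)‖ + ‖logDeriv χ⁻¹.LFunction (1 - s)‖ +
            ‖logDeriv (gammaFactor χ) (1 - s)‖ + ‖logDeriv (gammaFactor χ) s‖ := by
          refine (norm_sub_le _ _).trans ?_
          gcongr
          refine (norm_sub_le _ _).trans ?_
          gcongr
          exact norm_sub_le _ _
      _ ≤ Real.log q + C * (1 + 1 / η) * ℒ + (Real.log (|t| + 4) / 2 + 6) +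
            (Real.log (|t| + 4) / 2 + 6) := by rw [hlogqn]; gcongr
      _ = ℒ + 12 + C * (1 + 1 / η) * ℒ := by rw [hℒ]; ring
      _ ≤ ℒ / η + 12 * ℒ / η + 2 * C * ℒ / η := by
          have h1 : ℒ ≤ ℒ / η := by
            rw [le_div_iff₀ hη]; nlinarith
          have h2 : (12 : ℝ) ≤ 12 * ℒ / η := by
            rw [le_div_iff₀ hη]; nlinarith
          linarith
      _ = (2 * C + 13) * ℒ / η := by ring

end ExplicitPsiChar

end Literature.NumberTheory.LFunctions

end
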